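import Summits.CriticalPhenomena.PercolationContinuityZ3.Theorems.PercNearOneGluingNoHeavyLowerTailGiantKnStep
import Summits.CriticalPhenomena.PercolationContinuityZ3.Theorems.PercNearOneGluingNoHeavyLowerTailGiantKnLemmaTwo
import Summits.CriticalPhenomena.PercolationContinuityZ3.Theorems.PercNearOneGluingNoHeavyLowerTailOwnDisconnection
import HarnessLib

/-!
# `NoHeavyLowerTail` (stmt-CriticalPhenomena-4575) — `XZ₂` in Kozma–Nitzan's regime: the giant transfer of KN Theorem 2

Support file (prover `prim-lf-7`, lemma factory "k-cluster conditional association"; `--supports stmt-CriticalPhenomena-4575`).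
No definitions, no named facts, no sorries.

Setting: bond percolation `μ = prodBernoulli w` on `Fin n`, relays `A` with `|A| ≤ 2j+1` (the ladder: at most one heavy cluster),
"heavy" `:= j+1 ≤ |π(v)|`, "light" `:= |π(v)| ≤ j`.  The residual inequality of the crux chain (prim CANDIDATES, `XZ = CST`) is
`μ(1 ≤ N ≤ j, c heavy) ≤ μ(N ≥ j+1, c light)` for the champion `c`; its rung `XZ_T` restricts the observer's attachment to `o ↔ T`.
`XZ₁` (`T = {x}`) is `giant_pathExchange`; this file proves `XZ₂` (`T = {x,y}`) in KN's regime
`μ(c heavy, x,y light) ≤ μ(x,y heavy, c light)` — verbatim the proof of Kozma–Nitzan's Theorem 2 (arXiv:2401.12397, pp. 8–9) with the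
sink `𝔰` replaced by heaviness: six BHK applications (`GiantKn.pairStep`, `GiantKn.sideStep` twice) + Lemma 2 (`GiantKn.lemma2_pair`)
+ the telescoping `μ(x heavy) ≥ μ(c heavy)`, `μ(y heavy) ≥ μ(c heavy)`.
Outside KN's regime (anti-clustered triples) `XZ₂` is open (prim-lf-7 CANDIDATES.md batch 6: the unsplit KN certificate `LB ≥ 0` fails there).
-/

noncomputable section

namespace Summit.CriticalPhenomena.PercolationContinuityZ3.Theorems

open MeasureTheory Set Literature.Probability.LatticeModels Literature.Probability.Percolation
open scoped Classical BigOperators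

variable {n : ℕ}

/-- **XZ₂ in Kozma–Nitzan's regime (PROVED) — the giant transfer of KN Theorem 2.**  Let `|A| ≤ 2j+1`, `c, x, y` distinct,
`μ(x light) ≤ μ(c light)`, `μ(y light) ≤ μ(c light)`, suppose `c, x, y` are simultaneously separable with positive probability, and
assume KN's regime in giant form `μ(c heavy, x light, y light) ≤ μ(x heavy, y heavy, c light)` (the giant's trace on `{c,x,y}` is `{c}` no
more often than `{x,y}`).  Then the attached-champion inequality for the pair attachment `{x,y}` holds:
`μ((o↔x ∨ o↔y), o light, c heavy) ≤ μ((o↔x ∨ o↔y), o heavy, c light)`.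
Proof: decompose both sides by the heaviness pattern of `(x, y)` into three cells each, bound the three differences by `giant_knStep`
(`S = {x,y}, T = {c}`; `S = {x}, T = {y,c}`; `S = {y}, T = {x,c}`), use `knK_lemma2` (`φ_x + φ_y ≤ φ_{xy}`) on the first, and telescope
with `μ(x heavy) ≥ μ(c heavy)`, `μ(y heavy) ≥ μ(c heavy)` — verbatim Kozma–Nitzan, Theorem 2.
[cite: KozmaNitzan2024, Thm. 2 (pp. 8–9), Lemma 2 (p. 6); VandenbergHaggstromKahn2005, Thm. 2.1] -/
theorem xz2_of_knRegime (w : Sym2 (Fin n) → unitInterval) (A : Finset (Fin n)) (o c x y : Fin n) (j : ℕ)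
    (hA : A.card ≤ 2 * j + 1) (hxy : x ≠ y) (hxc : x ≠ c) (hyc : y ≠ c)
    (hx : (prodBernoulli w).real {ω : BondConfig (Fin n) | (A.filter fun a => ω ∈ openConn x a).card ≤ j} ≤
      (prodBernoulli w).real {ω : BondConfig (Fin n) | (A.filter fun a => ω ∈ openConn c a).card ≤ j})
    (hy : (prodBernoulli w).real {ω : BondConfig (Fin n) | (A.filter fun a => ω ∈ openConn y a).card ≤ j} ≤
      (prodBernoulli w).real {ω : BondConfig (Fin n) | (A.filter fun a => ω ∈ openConn c a).card ≤ j})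
    (hM : 0 < (prodBernoulli w).real {ω : BondConfig (Fin n) | ∀ k ∈ ({x, y} : Finset (Fin n)), ∀ l ∈ ({c, x, y} : Finset (Fin n)),
      k ≠ l → ¬ (openGraph ω).Reachable k l})
    (hreg : (prodBernoulli w).real ({ω : BondConfig (Fin n) | j + 1 ≤ (A.filter fun a => ω ∈ openConn c a).card} ∩
        {ω | (A.filter fun a => ω ∈ openConn x a).card ≤ j} ∩ {ω | (A.filter fun a => ω ∈ openConn y a).card ≤ j}) ≤
      (prodBernoulli w).real ({ω : BondConfig (Fin n) | j + 1 ≤ (A.filter fun a => ω ∈ openConn x a).card} ∩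
        {ω | j + 1 ≤ (A.filter fun a => ω ∈ openConn y a).card} ∩ {ω | (A.filter fun a => ω ∈ openConn c a).card ≤ j})) :
    (prodBernoulli w).real ((openConn o x ∪ openConn o y) ∩ {ω : BondConfig (Fin n) | (A.filter fun a => ω ∈ openConn o a).card ≤ j} ∩
        {ω | j + 1 ≤ (A.filter fun a => ω ∈ openConn c a).card}) ≤
      (prodBernoulli w).real ((openConn o x ∪ openConn o y) ∩ {ω : BondConfig (Fin n) | j + 1 ≤ (A.filter fun a => ω ∈ openConn o a).card} ∩
        {ω | (A.filter fun a => ω ∈ openConn c a).card ≤ j}) := by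
  obtain ⟨card_eq, lh, _⟩ := GiantKn.toolkit A j hA
  have k1 := GiantKn.pairStep w A o c x y j hA
  have k2 := GiantKn.sideStep w A o c x y j hA
  have k3 := GiantKn.sideStep w A o c y x j hA
  rw [union_comm (openConn o y : Set (BondConfig (Fin n))) (openConn o x)] at k3
  obtain ⟨pd1, pd2, pd3⟩ := GiantKn.sep_pos w c x y hxy hxc hyc hM
  have hL2 := GiantKn.lemma2_pair w o c x y hxy hxc hyc hM
  set μ := prodBernoulli w with hμ
  -- heaviness / lightness events
  set Hx : Set (BondConfig (Fin n)) := {ω | j + 1 ≤ (A.filter fun a => ω ∈ openConn x a).card} with hHx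
  set Hy : Set (BondConfig (Fin n)) := {ω | j + 1 ≤ (A.filter fun a => ω ∈ openConn y a).card} with hHy
  set Hc : Set (BondConfig (Fin n)) := {ω | j + 1 ≤ (A.filter fun a => ω ∈ openConn c a).card} with hHc
  set Ho : Set (BondConfig (Fin n)) := {ω | j + 1 ≤ (A.filter fun a => ω ∈ openConn o a).card} with hHo
  set Lx : Set (BondConfig (Fin n)) := {ω | (A.filter fun a => ω ∈ openConn x a).card ≤ j} with hLx
  set Ly : Set (BondConfig (Fin n)) := {ω | (A.filter fun a => ω ∈ openConn y a).card ≤ j} with hLy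
  set Lc : Set (BondConfig (Fin n)) := {ω | (A.filter fun a => ω ∈ openConn c a).card ≤ j} with hLc
  set Lo : Set (BondConfig (Fin n)) := {ω | (A.filter fun a => ω ∈ openConn o a).card ≤ j} with hLo
  set E : Set (BondConfig (Fin n)) := (openConn o x ∪ openConn o y) with hE
  have cx : Lxᶜ = Hx := by ext ω; simp only [mem_compl_iff, hLx, hHx, mem_setOf_eq, not_le]; omega
  have cy : Lyᶜ = Hy := by ext ω; simp only [mem_compl_iff, hLy, hHy, mem_setOf_eq, not_le]; omega
  have cc : Lcᶜ = Hc := by ext ω; simp only [mem_compl_iff, hLc, hHc, mem_setOf_eq, not_le]; omega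
  have cx' : Hxᶜ = Lx := by rw [← cx, compl_compl]
  have cy' : Hyᶜ = Ly := by rw [← cy, compl_compl]
  have uHx : ∀ ω, ω ∈ Hx ↔ j + 1 ≤ (A.filter fun a => ω ∈ openConn x a).card := fun ω => Iff.rfl
  have uHy : ∀ ω, ω ∈ Hy ↔ j + 1 ≤ (A.filter fun a => ω ∈ openConn y a).card := fun ω => Iff.rfl
  have uHc : ∀ ω, ω ∈ Hc ↔ j + 1 ≤ (A.filter fun a => ω ∈ openConn c a).card := fun ω => Iff.rfl
  have uHo : ∀ ω, ω ∈ Ho ↔ j + 1 ≤ (A.filter fun a => ω ∈ openConn o a).card := fun ω => Iff.rfl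
  have uLx : ∀ ω, ω ∈ Lx ↔ (A.filter fun a => ω ∈ openConn x a).card ≤ j := fun ω => Iff.rfl
  have uLy : ∀ ω, ω ∈ Ly ↔ (A.filter fun a => ω ∈ openConn y a).card ≤ j := fun ω => Iff.rfl
  have uLc : ∀ ω, ω ∈ Lc ↔ (A.filter fun a => ω ∈ openConn c a).card ≤ j := fun ω => Iff.rfl
  have uLo : ∀ ω, ω ∈ Lo ↔ (A.filter fun a => ω ∈ openConn o a).card ≤ j := fun ω => Iff.rfl
  have mE : ∀ ω, ω ∈ E ↔ ((openGraph ω).Reachable o x ∨ (openGraph ω).Reachable o y) := by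
    intro ω; simp only [hE, mem_union, openConn, mem_setOf_eq]
  ------------------------------------------------------------------
  -- NUMBERS
  set R1 := μ.real ((E ∩ Ho ∩ Lc) ∩ Hx ∩ Hy) with hR1
  set R2 := μ.real ((E ∩ Ho ∩ Lc) ∩ Hx ∩ Ly) with hR2
  set R3 := μ.real ((E ∩ Ho ∩ Lc) ∩ Hy ∩ Lx) with hR3
  set L1 := μ.real ((E ∩ Lo ∩ Hc) ∩ Lx ∩ Ly) with hL1
  set L2 := μ.real ((E ∩ Lo ∩ Hc) ∩ Hy) with hL2
  set L3 := μ.real ((E ∩ Lo ∩ Hc) ∩ Hx) with hL3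
  set Mxy := μ.real (Hx ∩ Hy ∩ Lc) with hMxy
  set Mc := μ.real (Hc ∩ Lx ∩ Ly) with hMc
  set Mx := μ.real (Hx ∩ Ly ∩ Lc) with hMx
  set Myc := μ.real (Hy ∩ Hc ∩ Lx) with hMyc
  set My := μ.real (Hy ∩ Lx ∩ Lc) with hMy
  set Mxc := μ.real (Hx ∩ Hc ∩ Ly) with hMxc
  set d1 := μ.real {ω : BondConfig (Fin n) | ¬ (openGraph ω).Reachable x c ∧ ¬ (openGraph ω).Reachable y c} with hd1
  set d2 := μ.real {ω : BondConfig (Fin n) | ¬ (openGraph ω).Reachable x y ∧ ¬ (openGraph ω).Reachable x c} with hd2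
  set d3 := μ.real {ω : BondConfig (Fin n) | ¬ (openGraph ω).Reachable y x ∧ ¬ (openGraph ω).Reachable y c} with hd3
  set a1 := μ.real ({ω : BondConfig (Fin n) | ¬ (openGraph ω).Reachable x c ∧ ¬ (openGraph ω).Reachable y c} ∩ E) with ha1
  set a2 := μ.real ({ω : BondConfig (Fin n) | ¬ (openGraph ω).Reachable x y ∧ ¬ (openGraph ω).Reachable x c} ∩ openConn o x) with ha2
  set a3 := μ.real ({ω : BondConfig (Fin n) | ¬ (openGraph ω).Reachable y x ∧ ¬ (openGraph ω).Reachable y c} ∩ openConn o y) with ha3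
  change (R1 - L1) * d1 ≥ a1 * (Mxy - Mc) at k1
  change (R2 - L2) * d2 ≥ a2 * (Mx - Myc) at k2
  change (R3 - L3) * d3 ≥ a3 * (My - Mxc) at k3
  change a2 / d2 + a3 / d3 ≤ a1 / d1 at hL2
  -- RHS = R1 + R2 + R3 ; LHS = L1 + L2 + L3
  have sR : μ.real (E ∩ Ho ∩ Lc) = R1 + R2 + R3 := by
    have s1 := OwnDisconnection.split w (E ∩ Ho ∩ Lc) Hx
    have s2 := OwnDisconnection.split w (E ∩ Ho ∩ Lc ∩ Hx) Hy
    have s3 := OwnDisconnection.split w (E ∩ Ho ∩ Lc ∩ Hxᶜ) Hy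
    rw [cy'] at s2 s3; rw [cx'] at s1 s3
    -- the (light, light) cell of the RHS is empty
    have h0 : μ.real (E ∩ Ho ∩ Lc ∩ Lx ∩ Ly) = 0 := by
      have : (E ∩ Ho ∩ Lc ∩ Lx ∩ Ly : Set (BondConfig (Fin n))) = ∅ := by
        ext ω; simp only [mem_inter_iff, and_assoc, mE ω, uHo, uLc, uLx, uLy, mem_empty_iff_false, iff_false]
        rintro ⟨hatt, hHo, _, hLx', hLy'⟩
        rcases hatt with h | h
        · rw [card_eq h] at hHo; omega
        · rw [card_eq h] at hHo; omega
      rw [this, measureReal_empty]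
    have e3 : (E ∩ Ho ∩ Lc ∩ Lx ∩ Hy : Set (BondConfig (Fin n))) = E ∩ Ho ∩ Lc ∩ Hy ∩ Lx := by
      ext ω; simp only [mem_inter_iff]; tauto
    rw [e3] at s3
    linarith
  have sL : μ.real (E ∩ Lo ∩ Hc) = L1 + L2 + L3 := by
    have s1 := OwnDisconnection.split w (E ∩ Lo ∩ Hc) Hy
    have s2 := OwnDisconnection.split w (E ∩ Lo ∩ Hc ∩ Hyᶜ) Hx
    rw [cy'] at s2; rw [cx'] at s2
    rw [cy'] at s1
    have e1 : (E ∩ Lo ∩ Hc ∩ Ly ∩ Hx : Set (BondConfig (Fin n))) = E ∩ Lo ∩ Hc ∩ Hx := by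
      ext ω; simp only [mem_inter_iff, and_assoc, mE ω, uLo, uHc, uLy, uHx]
      constructor
      · rintro ⟨hatt, hLo', hC, _, hX⟩; exact ⟨hatt, hLo', hC, hX⟩
      · rintro ⟨hatt, hLo', hC, hX⟩
        refine ⟨hatt, hLo', hC, ?_, hX⟩
        rcases hatt with h | h
        · exfalso; rw [card_eq h] at hLo'; omega
        · rw [← card_eq h]; exact hLo'
    have e2 : (E ∩ Lo ∩ Hc ∩ Ly ∩ Lx : Set (BondConfig (Fin n))) = E ∩ Lo ∩ Hc ∩ Lx ∩ Ly := by
      ext ω; simp only [mem_inter_iff]; tauto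
    rw [e1, e2] at s2
    linarith
  -- heaviness totals: μ(Hx) = Mx + Mxy + Mxc + Mxyc etc.; we only need μ(Hx) − μ(Hc) = Mx + Mxy − Mc − Myc and the y-analogue
  have tot : ∀ (P Q Rr : Set (BondConfig (Fin n))),
      μ.real P = μ.real (P ∩ Q ∩ Rr) + μ.real (P ∩ Q ∩ Rrᶜ) + μ.real (P ∩ Qᶜ ∩ Rr) + μ.real (P ∩ Qᶜ ∩ Rrᶜ) := by
    intro P Q Rr
    have s1 := OwnDisconnection.split w P Q
    have s2 := OwnDisconnection.split w (P ∩ Q) Rr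
    have s3 := OwnDisconnection.split w (P ∩ Qᶜ) Rr
    linarith
  have cc' : Hcᶜ = Lc := by rw [← cc, compl_compl]
  have hHx : μ.real Hx = μ.real (Hx ∩ Hy ∩ Hc) + Mxy + Mxc + Mx := by
    have := tot Hx Hy Hc
    rw [cc', cy'] at this
    have e2 : (Hx ∩ Ly ∩ Hc : Set (BondConfig (Fin n))) = Hx ∩ Hc ∩ Ly := by ext ω; simp only [mem_inter_iff]; tauto
    rw [e2] at this
    linarith
  have hHy' : μ.real Hy = μ.real (Hy ∩ Hx ∩ Hc) + μ.real (Hy ∩ Hx ∩ Lc) + Myc + My := by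
    have := tot Hy Hx Hc
    rw [cc', cx'] at this
    have e2 : (Hy ∩ Lx ∩ Hc : Set (BondConfig (Fin n))) = Hy ∩ Hc ∩ Lx := by ext ω; simp only [mem_inter_iff]; tauto
    rw [e2] at this
    linarith
  have hHc' : μ.real Hc = μ.real (Hc ∩ Hx ∩ Hy) + μ.real (Hc ∩ Hx ∩ Ly) + μ.real (Hc ∩ Lx ∩ Hy) + Mc := by
    have := tot Hc Hx Hy
    rw [cx', cy'] at this
    linarith
  have eA : (Hy ∩ Hx ∩ Hc : Set (BondConfig (Fin n))) = Hx ∩ Hy ∩ Hc := by ext ω; simp only [mem_inter_iff]; tauto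
  have eB : (Hc ∩ Hx ∩ Hy : Set (BondConfig (Fin n))) = Hx ∩ Hy ∩ Hc := by ext ω; simp only [mem_inter_iff]; tauto
  have eC : (Hy ∩ Hx ∩ Lc : Set (BondConfig (Fin n))) = Hx ∩ Hy ∩ Lc := by ext ω; simp only [mem_inter_iff]; tauto
  have eD : (Hc ∩ Hx ∩ Ly : Set (BondConfig (Fin n))) = Hx ∩ Hc ∩ Ly := by ext ω; simp only [mem_inter_iff]; tauto
  have eF : (Hc ∩ Lx ∩ Hy : Set (BondConfig (Fin n))) = Hy ∩ Hc ∩ Lx := by ext ω; simp only [mem_inter_iff]; tauto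
  rw [eA, eC] at hHy'; rw [eB, eD, eF] at hHc'
  -- μ(Hv) = 1 − μ(Lv)
  have hv : ∀ (Lv Hv : Set (BondConfig (Fin n))), Lvᶜ = Hv → μ.real Hv = 1 - μ.real Lv := by
    intro Lv Hv h
    have := OwnDisconnection.split w univ Lv
    rw [univ_inter, univ_inter, h, probReal_univ] at this; linarith
  have ghx : μ.real Hx ≥ μ.real Hc := by rw [hv Lx Hx cx, hv Lc Hc cc]; linarith
  have ghy : μ.real Hy ≥ μ.real Hc := by rw [hv Ly Hy cy, hv Lc Hc cc]; linarith
  have dx : Mx + Mxy - Mc - Myc ≥ 0 := by linarith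
  have dy : My + Mxy - Mc - Mxc ≥ 0 := by linarith
  -- φ's
  set px := a2 / d2 with hpx
  set py := a3 / d3 with hpy
  set pxy := a1 / d1 with hpxy
  have i1 : R1 - L1 ≥ pxy * (Mxy - Mc) := by
    rw [hpxy, ge_iff_le, div_mul_eq_mul_div, div_le_iff₀ pd1]; linarith
  have i2 : R2 - L2 ≥ px * (Mx - Myc) := by
    rw [hpx, ge_iff_le, div_mul_eq_mul_div, div_le_iff₀ pd2]; linarith
  have i3 : R3 - L3 ≥ py * (My - Mxc) := by
    rw [hpy, ge_iff_le, div_mul_eq_mul_div, div_le_iff₀ pd3]; linarith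
  have hreg' : Mxy - Mc ≥ 0 := by
    have e : (Hc ∩ Lx ∩ Ly : Set (BondConfig (Fin n))) = {ω : BondConfig (Fin n) | j + 1 ≤ (A.filter fun a => ω ∈ openConn c a).card} ∩
        {ω | (A.filter fun a => ω ∈ openConn x a).card ≤ j} ∩ {ω | (A.filter fun a => ω ∈ openConn y a).card ≤ j} := rfl
    linarith
  have hpx0 : 0 ≤ px := div_nonneg measureReal_nonneg measureReal_nonneg
  have hpy0 : 0 ≤ py := div_nonneg measureReal_nonneg measureReal_nonneg
  have i1' : R1 - L1 ≥ (px + py) * (Mxy - Mc) := le_trans (mul_le_mul_of_nonneg_right hL2 hreg') i1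
  -- assemble
  have eLHS : ((openConn o x ∪ openConn o y) ∩ {ω : BondConfig (Fin n) | (A.filter fun a => ω ∈ openConn o a).card ≤ j} ∩
      {ω | j + 1 ≤ (A.filter fun a => ω ∈ openConn c a).card} : Set (BondConfig (Fin n))) = E ∩ Lo ∩ Hc := rfl
  have eRHS : ((openConn o x ∪ openConn o y) ∩ {ω : BondConfig (Fin n) | j + 1 ≤ (A.filter fun a => ω ∈ openConn o a).card} ∩
      {ω | (A.filter fun a => ω ∈ openConn c a).card ≤ j} : Set (BondConfig (Fin n))) = E ∩ Ho ∩ Lc := rfl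
  rw [eLHS, eRHS, sL, sR]
  have H1 : (px + py) * (Mxy - Mc) + px * (Mx - Myc) + py * (My - Mxc) =
      px * (Mx + Mxy - Mc - Myc) + py * (My + Mxy - Mc - Mxc) := by ring
  have H2 : 0 ≤ px * (Mx + Mxy - Mc - Myc) := mul_nonneg hpx0 dx
  have H3 : 0 ≤ py * (My + Mxy - Mc - Mxc) := mul_nonneg hpy0 dy
  linarith [i1', i2, i3, H1, H2, H3]


end Summit.CriticalPhenomena.PercolationContinuityZ3.Theorems

end
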